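import Summits.Ventures.HodgeRepro2.T5LevelIdempotent

/-!
# Naturality of the level idempotent; exactness of `K`-invariants (Tier-5 kernel support, p8)

An equivariant linear map `f : V → W` between representations of `G` commutes with the level
averages: `f ∘ e_K = e_K ∘ f` (`map_levelAverage`).  Consequences, for `K`-finite `ρ` in
characteristic `0` (e.g. smooth `ρ` and compact `K`, `T5LevelIdempotent.kFinite_of_isSmooth`):
the `K`-invariants of the image are the image of the `K`-invariants
(`map_invariants_eq_range_inf`), and the functor `V ↦ V^K` preserves surjections
(`map_invariants_eq_of_surjective`, `invariantsMap_surjective`) — the exactness of the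
`K`-invariants functor on smooth representations, the profinite form of the finite-group sentence
used in T4-B3 §B7(b) / N1 §ID-2(c).  Nothing is asserted about any specific group.
-/

namespace Summit.Ventures.HodgeRepro2.T5LevelIdempotentNaturality

open Summit.Ventures.HodgeRepro2.LevelPositivity Summit.Ventures.HodgeRepro2.T5LevelIdempotent

variable {G : Type*} [Group G] {k : Type*} [Field k] {V : Type*} [AddCommGroup V] [Module k V]
  {W : Type*} [AddCommGroup W] [Module k W] {ρ : Representation k G V} {σ : Representation k G W}
  {f : V →ₗ[k] W}

/-- An equivariant map does not shrink stabilisers. -/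
theorem stabilizerIn_le_map (hf : ∀ g v, f (ρ g v) = σ g (f v)) (K : Subgroup G) (v : V) :
    stabilizerIn ρ K v ≤ stabilizerIn σ K (f v) := by
  intro κ hκ
  rw [mem_stabilizerIn_iff] at hκ ⊢
  rw [← hf, hκ]

/-- An equivariant map carries `K`-invariants to `K`-invariants. -/
theorem map_invariants_le (hf : ∀ g v, f (ρ g v) = σ g (f v)) (K : Subgroup G) :
    (invariants ρ K).map f ≤ invariants σ K := by
  intro w hw
  obtain ⟨v, hv, rfl⟩ := Submodule.mem_map.1 hw
  rw [mem_invariants_iff] at hv ⊢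
  intro g hg
  rw [← hf, hv g hg]

/-- An equivariant map commutes with coset sums. -/
theorem map_cosetSum (hf : ∀ g v, f (ρ g v) = σ g (f v)) {K : Subgroup G} (H : Subgroup K)
    [H.FiniteIndex] (v : V) : f (cosetSum ρ H v) = cosetSum σ H (f v) := by
  letI : Fintype (K ⧸ H) := Fintype.ofFinite _
  unfold cosetSum
  rw [finsum_eq_sum_of_fintype, finsum_eq_sum_of_fintype, map_sum]
  exact Finset.sum_congr rfl (fun _ _ => hf _ _)

/-- Naturality: `f ∘ e_K = e_K ∘ f` for an equivariant `f`. -/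
theorem map_levelAverage (hf : ∀ g v, f (ρ g v) = σ g (f v)) {K : Subgroup G} {v : V}
    [(stabilizerIn ρ K v).FiniteIndex] (hk : ((stabilizerIn ρ K v).index : k) ≠ 0) :
    f (levelAverage ρ K v) = levelAverage σ K (f v) := by
  rw [levelAverage_eq (stabilizerIn_le_map hf K v) hk]
  unfold levelAverage
  rw [map_smul, map_cosetSum hf]

/-- Naturality in characteristic `0`, for `K`-finite `ρ`. -/
theorem map_levelAverage' [CharZero k] (hf : ∀ g v, f (ρ g v) = σ g (f v)) {K : Subgroup G}
    (hK : KFinite ρ K) (v : V) : f (levelAverage ρ K v) = levelAverage σ K (f v) := by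
  haveI := hK v
  exact map_levelAverage hf (Nat.cast_ne_zero.2 Subgroup.FiniteIndex.index_ne_zero)

/-- The `K`-invariants of the image are the image of the `K`-invariants
(`K`-finite `ρ`, characteristic `0`). -/
theorem map_invariants_eq_range_inf [CharZero k] (hf : ∀ g v, f (ρ g v) = σ g (f v))
    {K : Subgroup G} (hK : KFinite ρ K) :
    (invariants ρ K).map f = LinearMap.range f ⊓ invariants σ K := by
  apply le_antisymm
  · exact le_inf (Submodule.map_le_iff_le_comap.2 fun v _ => LinearMap.mem_range_self f v)
      (map_invariants_le hf K)
  · rintro w ⟨⟨v, rfl⟩, hw⟩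
    haveI := hK v
    refine ⟨levelAverage ρ K v, levelAverage_mem_invariants, ?_⟩
    rw [map_levelAverage' hf hK, levelAverage_of_mem_invariants hw]

/-- A surjective equivariant map is surjective on `K`-invariants
(`K`-finite `ρ`, characteristic `0`). -/
theorem map_invariants_eq_of_surjective [CharZero k] (hf : ∀ g v, f (ρ g v) = σ g (f v))
    {K : Subgroup G} (hK : KFinite ρ K) (hs : Function.Surjective f) :
    (invariants ρ K).map f = invariants σ K := by
  rw [map_invariants_eq_range_inf hf hK, LinearMap.range_eq_top.2 hs, top_inf_eq]

/-- The restriction of an equivariant map to the `K`-invariants. -/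
noncomputable def invariantsMap (f : V →ₗ[k] W) (hf : ∀ g v, f (ρ g v) = σ g (f v)) (K : Subgroup G) :
    invariants ρ K →ₗ[k] invariants σ K :=
  f.restrict fun v hv => map_invariants_le hf K ⟨v, hv, rfl⟩

/-- `invariantsMap` is the restriction of `f`. -/
@[simp] theorem invariantsMap_apply (hf : ∀ g v, f (ρ g v) = σ g (f v)) (K : Subgroup G)
    (v : invariants ρ K) : (invariantsMap f hf K v : W) = f v :=
  rfl

/-- `invariantsMap` is injective when `f` is. -/
theorem invariantsMap_injective (hf : ∀ g v, f (ρ g v) = σ g (f v)) (K : Subgroup G)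
    (hi : Function.Injective f) : Function.Injective (invariantsMap f hf K) := by
  intro v w h
  exact Subtype.ext (hi (congrArg Subtype.val h))

/-- Exactness of `V ↦ V^K`: `invariantsMap` is surjective when `f` is
(`K`-finite `ρ`, characteristic `0`). -/
theorem invariantsMap_surjective [CharZero k] (hf : ∀ g v, f (ρ g v) = σ g (f v))
    {K : Subgroup G} (hK : KFinite ρ K) (hs : Function.Surjective f) :
    Function.Surjective (invariantsMap f hf K) := by
  rintro ⟨w, hw⟩
  obtain ⟨v, rfl⟩ := hs w
  haveI := hK v
  refine ⟨⟨levelAverage ρ K v, levelAverage_mem_invariants⟩, Subtype.ext ?_⟩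
  rw [invariantsMap_apply, map_levelAverage' hf hK, levelAverage_of_mem_invariants hw]

/-- The level idempotent of `W` restricted to the image of `f` is the image of the level
idempotent of `V`: `e_K (f v) = f (e_K v)` as an identity of linear maps
(`K`-finite `ρ` and `σ`, characteristic `0`). -/
theorem levelIdempotent_comp [CharZero k] (hf : ∀ g v, f (ρ g v) = σ g (f v)) {K : Subgroup G}
    (hK : KFinite ρ K) (hK' : KFinite σ K) :
    levelIdempotent K hK' ∘ₗ f = f ∘ₗ levelIdempotent K hK := by
  refine LinearMap.ext fun v => ?_
  simp only [LinearMap.comp_apply, levelIdempotent_apply]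
  exact (map_levelAverage' hf hK v).symm

end Summit.Ventures.HodgeRepro2.T5LevelIdempotentNaturality
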